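import Mathlib.RepresentationTheory.Homological.GroupHomology.LowDegree
import HarnessLib

/-!
# Endomorphisms of `H₁(G, A)` induced by chain maps in degree one that preserve cycles and boundaries

Topic `Literature/Algebra/Homology`; namespace `Literature.Algebra.Homology.H1Endo`.  Definitions with bodies + proved
theorems; no named fact, no `sorry`, no instance, no notation.

Mathlib's functoriality `groupHomology.map` covers morphisms of PAIRS (group hom + equivariant coefficient map).  Hecke
operators are not of that form: they are given on inhomogeneous `1`-chains by explicit transfer formulas.  This file provides
the missing plumbing: for a `k`-linear map `T : C₁(G, A) → C₁(G, A)` (`C₁ = G →₀ A`) with `T(Z₁) ⊆ Z₁` and `T(B₁) ⊆ B₁`,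
**`lift A T hZ hB : H₁(G, A) →ₗ[k] H₁(G, A)`** with **`lift_H1π`**: `lift T [x] = [T x]`; uniqueness (`lift_unique`), `lift_id`,
`lift_comp`.  (Via `H₁ = Z₁ ⧸ ker H1π`, `ker H1π = {x : x.1 ∈ B₁}` = Mathlib `H1π_eq_zero_iff`, and `Submodule.mapQ`.)

## References
* K. S. Brown, *Cohomology of Groups* (1982), Ch. III §9–§10 (transfer and Hecke-type operators on chains). [Brown1982]
-/

noncomputable section

open CategoryTheory groupHomology Finsupp

universe u

namespace Literature.Algebra.Homology

namespace H1Endo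

variable {k : Type u} [CommRing k] {G : Type u} [Group G] (A : Rep k G)

/-- `H1π : Z₁(G, A) → H₁(G, A)` as a `k`-linear map (Mathlib's `H1π`, unbundled). [cite: Brown1982, Ch. III §1] -/
abbrev proj : cycles₁ A →ₗ[k] H1 A := (H1π A).hom

/-- `H1π` is onto. [cite: Brown1982, Ch. III §1] -/
theorem proj_surjective : Function.Surjective (proj A) :=
  (ModuleCat.epi_iff_surjective (H1π A)).1 inferInstance

/-- `ker H1π = {x ∈ Z₁ : x ∈ B₁}`. [cite: Brown1982, Ch. III §1] -/
theorem mem_ker_proj_iff (x : cycles₁ A) : x ∈ LinearMap.ker (proj A) ↔ x.1 ∈ boundaries₁ A := by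
  rw [LinearMap.mem_ker]
  exact H1π_eq_zero_iff x

variable {A}
variable (T : (G →₀ A) →ₗ[k] (G →₀ A)) (hZ : ∀ x ∈ cycles₁ A, T x ∈ cycles₁ A)
  (hB : ∀ x ∈ boundaries₁ A, T x ∈ boundaries₁ A)

/-- The restriction of `T` to `1`-cycles. [cite: Brown1982, Ch. III §9] -/
def onCycles : cycles₁ A →ₗ[k] cycles₁ A := T.restrict hZ

/-- Unfolding `onCycles`. [cite: Brown1982, Ch. III §9] -/
theorem coe_onCycles (x : cycles₁ A) : (onCycles T hZ x).1 = T x.1 := rfl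

include hB in
/-- `onCycles T` preserves `ker H1π`. [cite: Brown1982, Ch. III §9] -/
theorem ker_le_comap : LinearMap.ker (proj A) ≤ (LinearMap.ker (proj A)).comap (onCycles T hZ) := by
  intro x hx
  rw [Submodule.mem_comap, mem_ker_proj_iff, coe_onCycles]
  exact hB _ ((mem_ker_proj_iff A x).1 hx)

variable (A) in
/-- `H₁(G, A) ≃ Z₁ ⧸ ker H1π`. [cite: Brown1982, Ch. III §1] -/
def quotEquiv : (cycles₁ A ⧸ LinearMap.ker (proj A)) ≃ₗ[k] H1 A :=
  (proj A).quotKerEquivOfSurjective (proj_surjective A)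

/-- **The endomorphism of `H₁(G, A)` induced by a chain map preserving cycles and boundaries.**
[cite: Brown1982, Ch. III §9] -/
def lift : H1 A →ₗ[k] H1 A :=
  (quotEquiv A).toLinearMap ∘ₗ (LinearMap.ker (proj A)).mapQ (LinearMap.ker (proj A)) (onCycles T hZ)
    (ker_le_comap T hZ hB) ∘ₗ (quotEquiv A).symm.toLinearMap

/-- **`lift T [x] = [T x]`.** [cite: Brown1982, Ch. III §9] -/
theorem lift_H1π (x : cycles₁ A) : lift T hZ hB (H1π A x) = H1π A ⟨T x.1, hZ _ x.2⟩ := by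
  have hsymm : (quotEquiv A).symm (H1π A x) = Submodule.Quotient.mk x := by
    rw [LinearEquiv.symm_apply_eq]
    rfl
  simp only [lift, LinearMap.coe_comp, LinearEquiv.coe_coe, Function.comp_apply, hsymm, Submodule.mapQ_apply]
  rfl

/-- Uniqueness: an endomorphism agreeing with `[x] ↦ [T x]` on classes is `lift T`. [cite: Brown1982, Ch. III §9] -/
theorem lift_unique (L : H1 A →ₗ[k] H1 A) (hL : ∀ x : cycles₁ A, L (H1π A x) = H1π A ⟨T x.1, hZ _ x.2⟩) :
    L = lift T hZ hB := by
  apply LinearMap.ext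
  intro z
  induction z using H1_induction_on with
  | h x => rw [hL, lift_H1π]

/-- `lift id = id`. [cite: Brown1982, Ch. III §9] -/
theorem lift_id : lift (A := A) LinearMap.id (fun _ hx => hx) (fun _ hx => hx) = LinearMap.id := by
  symm
  refine lift_unique _ _ _ _ (fun x => ?_)
  rfl

/-- `lift (T ∘ T') = lift T ∘ lift T'`. [cite: Brown1982, Ch. III §9] -/
theorem lift_comp (T' : (G →₀ A) →ₗ[k] (G →₀ A)) (hZ' : ∀ x ∈ cycles₁ A, T' x ∈ cycles₁ A)
    (hB' : ∀ x ∈ boundaries₁ A, T' x ∈ boundaries₁ A) :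
    lift (T ∘ₗ T') (fun x hx => hZ _ (hZ' x hx)) (fun x hx => hB _ (hB' x hx)) =
      lift T hZ hB ∘ₗ lift T' hZ' hB' := by
  symm
  refine lift_unique _ _ _ _ (fun x => ?_)
  rw [LinearMap.comp_apply, lift_H1π, lift_H1π]
  rfl

/-- `lift` is additive in `T`. [cite: Brown1982, Ch. III §9] -/
theorem lift_add (T' : (G →₀ A) →ₗ[k] (G →₀ A)) (hZ' : ∀ x ∈ cycles₁ A, T' x ∈ cycles₁ A)
    (hB' : ∀ x ∈ boundaries₁ A, T' x ∈ boundaries₁ A) :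
    lift (T + T') (fun x hx => (cycles₁ A).add_mem (hZ x hx) (hZ' x hx))
        (fun x hx => (boundaries₁ A).add_mem (hB x hx) (hB' x hx)) =
      lift T hZ hB + lift T' hZ' hB' := by
  symm
  refine lift_unique _ _ _ _ (fun x => ?_)
  rw [LinearMap.add_apply, lift_H1π, lift_H1π, ← map_add]
  rfl

end H1Endo

end Literature.Algebra.Homology
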